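import Summits.Ventures.Crystal3D.Theorems.StickyWulffConstantTextureLiminfCubeRigidity
import Summits.Ventures.Crystal3D.Theorems.StickyWulffConstantTextureBuildLocalAgreement
import Summits.Ventures.Crystal3D.Theorems.StickyWulffConstantTextureBuildHealBook
import HarnessLib

/-!
# TB-1 brick: LOCAL CHARTS — away from the non-close-packed balls every ball carries a COMPLETE local Barlow stacking, and overlapping charts AGREE
# (lane T, crux `TextureLiminfV5`, stmt-Ventures-23912; blueprint HOME/wulff-p2/g23/TB-COVER-BLUEPRINT-g23.md S2/S4, memo HOME/wulff-p2/g25/SLAB-PLATES-g25.md §4)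

HONEST FRAMING. Venture `Summits/Ventures/Crystal3D` (cell `crystal3d-full`), route `route-Ventures-StickyWulffConstant`, helper `--supports` the
law-v5 crux `TextureLiminfV5` (stmt-Ventures-23912).  Corollaries (census-free, standard axioms) of the tree's `ballRigidity` ('…TextureLiminfCubeRigidity')
and `mem_of_perfect_near` / `mem_iff_mem_of_perfect_near` ('…TextureBuildLocalAgreement').  No cover is built; F-C1 not moved.

WHY.  The constructor of the healed `stub_TB_cover` must extend the grains of the resolution (good grid cubes, certified far from every defect) through the
UNCERTIFIED zone up to the plates of its wall cells, and must know, for the pigeonhole of '…TextureBuildSlabPlates', that a cell column on grain `f`'s side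
holds few `S_f`-defects.  Both rest on LOCAL CHARTS: wherever no ball with a non-close-packed first shell is near, the packing is locally a COMPLETE piece of
ONE Barlow stacking, and two such pieces around nearby balls coincide as site sets on their overlap.  This file packages exactly that:

* `twelve_le_card_filter_of_isClosePackedShell` — a close-packed shell gives twelve balls of the point set at distance `1`;
* **`exists_complete_chart`** — if every ball within `168ℓ + 196` of `x i₀` has a close-packed shell (`ℓ ≥ 2`), there is a moved Hägg stacking `S`
  carrying every ball within `ℓ` of `x i₀` AND complete within `ℓ − 2` of `x i₀` (every site of `S` there is a ball);
* `chart_complete` — the completeness half alone (any stacking carrying the balls within `ℓ`, shells close-packed within `ℓ − 1`);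
* **`chart_agree`** / `chart_inter_ball_eq` — two stackings carrying the balls within `ℓ` of `x i₀` resp. `x j₀`, `dist (x i₀) (x j₀) ≤ d ≤ ℓ − 2`,
  coincide as site sets within `ℓ − 2 − d` of `x i₀` (point form and the `S_f ∩ ball = S_g ∩ ball` form of `Mesh.hagree`);
* `isClosePackedShell_of_far`, **`exists_complete_chart_of_far`** — the hypothesis in the form the constructor has it: no ball of `nonClosePacked x` within
  `168ℓ + 196` of `x i₀`;
* **`card_near_nonClosePacked_le`** — under `L12Local`, the balls within `Λ ≥ 1` of some non-close-packed ball number `≤ 24·(6N − b)·(2Λ + 1)³`: all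
  other balls carry complete charts of radius `ℓ` (`Λ = 168ℓ + 196`), so the uncharted zone — where walls, junk and plates live — has `O(N^{2/3})` balls.
-/

noncomputable section

namespace Summit.Ventures.Crystal3D.Theorems

open Finset Summit.Ventures.Crystal3D
open Literature.MathematicalPhysics.StatisticalMechanics (IsHaggSeq)
open Summit.Ventures.Crystal3D.Cruxes.TextureLiminf.TexShadow (E3 stacking)

variable {N : ℕ} {x : Fin N → E3}

/-! ## Twelve contacts on the point set -/

/-- A ball with a close-packed first shell has twelve balls of the configuration's point set at distance `1`. -/
theorem twelve_le_card_filter_of_isClosePackedShell (hx : IsUnitPacking x) {i : Fin N} (h : IsClosePackedShell x i) :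
    12 ≤ ((Finset.univ.image x).filter fun y => dist (x i) y = 1).card := by
  classical
  have h12 : (contactNeighbors x i).card = 12 := h.coordination_eq hx
  rw [← h12]
  have hsub : (contactNeighbors x i).image x ⊆ (Finset.univ.image x).filter fun y => dist (x i) y = 1 := by
    intro y hy
    rw [Finset.mem_image] at hy
    obtain ⟨j, hj, rfl⟩ := hy
    rw [mem_contactNeighbors] at hj
    exact Finset.mem_filter.2 ⟨Finset.mem_image_of_mem _ (Finset.mem_univ _), hj.2⟩
  calc (contactNeighbors x i).card = ((contactNeighbors x i).image x).card := (Finset.card_image_of_injective _ hx.injective).symm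
    _ ≤ _ := Finset.card_le_card hsub

/-! ## Complete charts -/

section Chart

variable {L : E3 ≃ₗᵢ[ℝ] E3} {s : E3} {σ : ℤ → ℤ}

/-- **Completeness of a chart**: if a Hägg stacking carries every ball within `ℓ` of `x i₀` and every ball within `ℓ − 1` of `x i₀` has a close-packed
shell, then every SITE of the stacking within `ℓ − 2` of `x i₀` is a ball. -/
theorem chart_complete (hx : IsUnitPacking x) (hσ : IsHaggSeq σ) {i₀ : Fin N} {ℓ : ℝ} (hℓ : 0 ≤ ℓ)
    (hS : ∀ i, dist (x i) (x i₀) ≤ ℓ → x i ∈ stacking L s σ)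
    (hcp : ∀ i, dist (x i) (x i₀) ≤ ℓ - 1 → IsClosePackedShell x i) :
    ∀ w ∈ stacking L s σ, dist w (x i₀) ≤ ℓ - 2 → w ∈ Set.range x := by
  classical
  intro w hw hwd
  have hp₀ : x i₀ ∈ Finset.univ.image x := Finset.mem_image_of_mem _ (Finset.mem_univ _)
  have hp₀S : x i₀ ∈ stacking L s σ := hS i₀ (by rw [dist_self]; exact hℓ)
  have hS' : ∀ y ∈ Finset.univ.image x, dist y (x i₀) ≤ (ℓ - 2) + 2 → y ∈ stacking L s σ := by
    intro y hy hyd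
    obtain ⟨i, -, rfl⟩ := Finset.mem_image.1 hy
    exact hS i (by linarith)
  have h12 : ∀ y ∈ Finset.univ.image x, dist y (x i₀) ≤ (ℓ - 2) + 1 →
      12 ≤ ((Finset.univ.image x).filter fun z => dist y z = 1).card := by
    intro y hy hyd
    obtain ⟨i, -, rfl⟩ := Finset.mem_image.1 hy
    exact twelve_le_card_filter_of_isClosePackedShell hx (hcp i (by linarith))
  have h := mem_of_perfect_near hσ (Finset.univ.image x) hp₀ hp₀S (ℓ - 2) hS' h12 w hw hwd
  exact mem_image_univ_iff_mem_range.1 h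

/-- **EXISTENCE OF A COMPLETE CHART** (`ℓ ≥ 0`): if every ball within `168ℓ + 196` of `x i₀` has a close-packed first shell, some moved Hägg stacking carries
every ball within `ℓ` of `x i₀` and is complete within `ℓ − 2` of `x i₀`. -/
theorem exists_complete_chart (hx : IsUnitPacking x) (i₀ : Fin N) {ℓ : ℝ} (hℓ : 0 ≤ ℓ)
    (hcp : ∀ i, dist (x i) (x i₀) ≤ 168 * ℓ + 196 → IsClosePackedShell x i) :
    ∃ (L : E3 ≃ₗᵢ[ℝ] E3) (s : E3) (σ : ℤ → ℤ), IsHaggSeq σ ∧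
      (∀ i, dist (x i) (x i₀) ≤ ℓ → x i ∈ stacking L s σ) ∧
      (∀ w ∈ stacking L s σ, dist w (x i₀) ≤ ℓ - 2 → w ∈ Set.range x) := by
  obtain ⟨L, s, σ, hσ, hS⟩ := ballRigidity hx i₀ hℓ hcp
  exact ⟨L, s, σ, hσ, hS, chart_complete hx hσ hℓ hS fun i hi => hcp i (by linarith)⟩

/-- The chart contains its centre. -/
theorem mem_chart_self {i₀ : Fin N} {ℓ : ℝ} (hℓ : 0 ≤ ℓ) (hS : ∀ i, dist (x i) (x i₀) ≤ ℓ → x i ∈ stacking L s σ) :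
    x i₀ ∈ stacking L s σ :=
  hS i₀ (by rw [dist_self]; exact hℓ)

end Chart

/-! ## Agreement of overlapping charts -/

section Agree

variable {L₁ L₂ : E3 ≃ₗᵢ[ℝ] E3} {s₁ s₂ : E3} {σ₁ σ₂ : ℤ → ℤ}

/-- **AGREEMENT OF CHARTS**: a stacking carrying the balls within `ℓ` of `x i₀` and one carrying the balls within `ℓ` of `x j₀`, `dist (x i₀) (x j₀) ≤ d`,
`0 ≤ ℓ − 2 − d`, shells close-packed within `ℓ − 1` of `x i₀`: the two stackings have the same sites within `ℓ − 2 − d` of `x i₀`. -/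
theorem chart_agree (hx : IsUnitPacking x) (hσ₁ : IsHaggSeq σ₁) (hσ₂ : IsHaggSeq σ₂) {i₀ j₀ : Fin N} {ℓ d : ℝ}
    (hd : dist (x i₀) (x j₀) ≤ d) (hℓd : 0 ≤ ℓ - 2 - d)
    (hS₁ : ∀ i, dist (x i) (x i₀) ≤ ℓ → x i ∈ stacking L₁ s₁ σ₁)
    (hS₂ : ∀ i, dist (x i) (x j₀) ≤ ℓ → x i ∈ stacking L₂ s₂ σ₂)
    (hcp : ∀ i, dist (x i) (x i₀) ≤ ℓ - 1 → IsClosePackedShell x i) :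
    ∀ z : E3, dist z (x i₀) ≤ ℓ - 2 - d → (z ∈ stacking L₁ s₁ σ₁ ↔ z ∈ stacking L₂ s₂ σ₂) := by
  classical
  have hd0 : 0 ≤ d := dist_nonneg.trans hd
  have hp₀ : x i₀ ∈ Finset.univ.image x := Finset.mem_image_of_mem _ (Finset.mem_univ _)
  have hp₀S₁ : x i₀ ∈ stacking L₁ s₁ σ₁ := hS₁ i₀ (by rw [dist_self]; linarith)
  have hp₀S₂ : x i₀ ∈ stacking L₂ s₂ σ₂ := hS₂ i₀ (by linarith)
  have hS₁' : ∀ y ∈ Finset.univ.image x, dist y (x i₀) ≤ (ℓ - 2 - d) + 2 → y ∈ stacking L₁ s₁ σ₁ := by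
    intro y hy hyd
    obtain ⟨i, -, rfl⟩ := Finset.mem_image.1 hy
    exact hS₁ i (by linarith)
  have hS₂' : ∀ y ∈ Finset.univ.image x, dist y (x i₀) ≤ (ℓ - 2 - d) + 2 → y ∈ stacking L₂ s₂ σ₂ := by
    intro y hy hyd
    obtain ⟨i, -, rfl⟩ := Finset.mem_image.1 hy
    refine hS₂ i ?_
    have := dist_triangle (x i) (x i₀) (x j₀)
    linarith
  have h12 : ∀ y ∈ Finset.univ.image x, dist y (x i₀) ≤ (ℓ - 2 - d) + 1 →
      12 ≤ ((Finset.univ.image x).filter fun z => dist y z = 1).card := by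
    intro y hy hyd
    obtain ⟨i, -, rfl⟩ := Finset.mem_image.1 hy
    exact twelve_le_card_filter_of_isClosePackedShell hx (hcp i (by linarith))
  exact mem_iff_mem_of_perfect_near hσ₁ hσ₂ (Finset.univ.image x) hp₀ hp₀S₁ hp₀S₂ (ℓ - 2 - d) hS₁' hS₂' h12

/-- **Agreement of charts, `Mesh.hagree` form**: under the hypotheses of `chart_agree`, for every ball `Metric.ball y r ⊆ closedBall (x i₀) (ℓ − 2 − d)`,
`stacking₁ ∩ ball y r = stacking₂ ∩ ball y r`. -/
theorem chart_inter_ball_eq (hx : IsUnitPacking x) (hσ₁ : IsHaggSeq σ₁) (hσ₂ : IsHaggSeq σ₂) {i₀ j₀ : Fin N} {ℓ d : ℝ}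
    (hd : dist (x i₀) (x j₀) ≤ d) (hℓd : 0 ≤ ℓ - 2 - d)
    (hS₁ : ∀ i, dist (x i) (x i₀) ≤ ℓ → x i ∈ stacking L₁ s₁ σ₁)
    (hS₂ : ∀ i, dist (x i) (x j₀) ≤ ℓ → x i ∈ stacking L₂ s₂ σ₂)
    (hcp : ∀ i, dist (x i) (x i₀) ≤ ℓ - 1 → IsClosePackedShell x i)
    {y : E3} {r : ℝ} (hyr : Metric.ball y r ⊆ Metric.closedBall (x i₀) (ℓ - 2 - d)) :
    stacking L₁ s₁ σ₁ ∩ Metric.ball y r = stacking L₂ s₂ σ₂ ∩ Metric.ball y r := by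
  ext z
  simp only [Set.mem_inter_iff]
  constructor
  · rintro ⟨hz, hzb⟩
    exact ⟨(chart_agree hx hσ₁ hσ₂ hd hℓd hS₁ hS₂ hcp z (Metric.mem_closedBall.1 (hyr hzb))).1 hz, hzb⟩
  · rintro ⟨hz, hzb⟩
    exact ⟨(chart_agree hx hσ₁ hσ₂ hd hℓd hS₁ hS₂ hcp z (Metric.mem_closedBall.1 (hyr hzb))).2 hz, hzb⟩

/-- **A chart carries the balls of any agreeing chart's region**: under the hypotheses of `chart_agree`, every ball within `ℓ − 2 − d` of `x i₀` lies on
BOTH stackings (so charts can be chained: the far chart's stacking carries the near material). -/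
theorem mem_of_chart_agree (hx : IsUnitPacking x) (hσ₁ : IsHaggSeq σ₁) (hσ₂ : IsHaggSeq σ₂) {i₀ j₀ : Fin N} {ℓ d : ℝ}
    (hd : dist (x i₀) (x j₀) ≤ d) (hℓd : 0 ≤ ℓ - 2 - d)
    (hS₁ : ∀ i, dist (x i) (x i₀) ≤ ℓ → x i ∈ stacking L₁ s₁ σ₁)
    (hS₂ : ∀ i, dist (x i) (x j₀) ≤ ℓ → x i ∈ stacking L₂ s₂ σ₂)
    (hcp : ∀ i, dist (x i) (x i₀) ≤ ℓ - 1 → IsClosePackedShell x i) :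
    ∀ i, dist (x i) (x i₀) ≤ ℓ - 2 - d → x i ∈ stacking L₁ s₁ σ₁ ∧ x i ∈ stacking L₂ s₂ σ₂ := by
  intro i hi
  have hd0 : 0 ≤ d := dist_nonneg.trans hd
  have h1 : x i ∈ stacking L₁ s₁ σ₁ := hS₁ i (by linarith)
  exact ⟨h1, (chart_agree hx hσ₁ hσ₂ hd hℓd hS₁ hS₂ hcp (x i) hi).1 h1⟩

end Agree

/-! ## The hypothesis in the constructor's form, and the size of the uncharted zone -/

section Far

/-- A ball with no non-close-packed ball within `Λ ≥ 0` of it has (trivially, `Λ ≥ 0` and itself) a close-packed shell; more usefully: every ball within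
`Λ` of it has one. -/
theorem isClosePackedShell_of_far {i₀ : Fin N} {Λ : ℝ} (hfar : ∀ j ∈ nonClosePacked x, Λ < dist (x j) (x i₀)) :
    ∀ i, dist (x i) (x i₀) ≤ Λ → IsClosePackedShell x i := by
  intro i hi
  by_contra h
  exact absurd hi (not_le.2 (hfar i (mem_nonClosePacked.2 h)))

/-- **COMPLETE CHART AROUND A FAR BALL**: if no ball of `nonClosePacked x` lies within `168ℓ + 196` of `x i₀` (`ℓ ≥ 0`), then `x i₀` carries a complete
chart of radius `ℓ` (balls within `ℓ` on the stacking, sites within `ℓ − 2` occupied), and every ball within `168ℓ + 196` of it has a close-packed shell. -/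
theorem exists_complete_chart_of_far (hx : IsUnitPacking x) (i₀ : Fin N) {ℓ : ℝ} (hℓ : 0 ≤ ℓ)
    (hfar : ∀ j ∈ nonClosePacked x, 168 * ℓ + 196 < dist (x j) (x i₀)) :
    ∃ (L : E3 ≃ₗᵢ[ℝ] E3) (s : E3) (σ : ℤ → ℤ), IsHaggSeq σ ∧
      (∀ i, dist (x i) (x i₀) ≤ ℓ → x i ∈ stacking L s σ) ∧
      (∀ w ∈ stacking L s σ, dist w (x i₀) ≤ ℓ - 2 → w ∈ Set.range x) ∧
      (∀ i, dist (x i) (x i₀) ≤ 168 * ℓ + 196 → IsClosePackedShell x i) := by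
  have hcp := isClosePackedShell_of_far hfar
  obtain ⟨L, s, σ, hσ, hS, hc⟩ := exists_complete_chart hx i₀ hℓ hcp
  exact ⟨L, s, σ, hσ, hS, hc, hcp⟩

open scoped Classical in
/-- **THE UNCHARTED ZONE IS SMALL** (under `L12Local`): the balls within `Λ ≥ 1` of some ball with a non-close-packed shell number at most
`24·(6N − b)·(2Λ + 1)³`. -/
theorem card_near_nonClosePacked_le (hL : L12Local) (hx : IsUnitPacking x) {Λ : ℝ} (hΛ : 1 ≤ Λ) :
    ((Finset.univ.filter fun i => ∃ j ∈ nonClosePacked x, dist (x i) (x j) ≤ Λ).card : ℝ) ≤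
      24 * (6 * (N : ℝ) - (numContacts x : ℝ)) * (2 * Λ + 1) ^ 3 := by
  have h1 := card_filter_near_le hx (nonClosePacked x) hΛ
  have h2 := card_nonClosePacked_le hL hx
  have h3 : (0 : ℝ) ≤ (2 * Λ + 1) ^ 3 := by positivity
  calc ((Finset.univ.filter fun i => ∃ j ∈ nonClosePacked x, dist (x i) (x j) ≤ Λ).card : ℝ)
      ≤ ((nonClosePacked x).card : ℝ) * (2 * Λ + 1) ^ 3 := h1
    _ ≤ 24 * (6 * (N : ℝ) - (numContacts x : ℝ)) * (2 * Λ + 1) ^ 3 := mul_le_mul_of_nonneg_right h2 h3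

open scoped Classical in
/-- Complement form: a ball NOT in the uncharted zone of radius `Λ` is `Λ`-far from every non-close-packed ball. -/
theorem far_of_not_mem_near {i₀ : Fin N} {Λ : ℝ}
    (h : i₀ ∉ Finset.univ.filter fun i => ∃ j ∈ nonClosePacked x, dist (x i) (x j) ≤ Λ) :
    ∀ j ∈ nonClosePacked x, Λ < dist (x j) (x i₀) := by
  intro j hj
  by_contra hle
  push Not at hle
  exact h (Finset.mem_filter.2 ⟨Finset.mem_univ _, j, hj, by rw [dist_comm]; exact hle⟩)

end Far

end Summit.Ventures.Crystal3D.Theorems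

end
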